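import Summits.BirchSwinnertonDyer.BirchSwinnertonDyer.Theorems.ByReductionTypeAtTwoSupersingularFlatPTLayerKummerDatum
import Summits.BirchSwinnertonDyer.BirchSwinnertonDyer.Theorems.ByReductionTypeAtTwoSupersingularFlatKernelClosed
import Summits.BirchSwinnertonDyer.BirchSwinnertonDyer.Theorems.ThetaPartnerAtTwoSignedKatoUpToAtTwoLayerPairingCompat
import Literature.NumberTheory.EllipticCurves.IwasawaSelmerProofs
import HarnessLib

/-!
# Route `ByReductionTypeAtTwo` (rung K4), crux `SupersingularRankZeroAtTwo` (item stmt-BirchSwinnertonDyer-19097), line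
# `odd_blind_package` v2.17, stub `stub_flatPackage`, conjunct (8), clause F1♭ — joint J3(v) of the hF1♭-LIM/hF1♭-LEV seam,
# part 2: **THE CONJUGATES CLAUSE** — `conj_σ θ_{n,k}(s)` satisfies the ♭-local condition for EVERY `σ ∈ Γ_ℚ`, hence
# `θ_{n,k}(s) ∈ Sel♭(ℚ_∞)` as soon as it is a classical Selmer class (cell `bsd-2adic`, seat `bsd-2adic-t42` GEN 49;
# `--supports 19097`, helper)

HONEST FRAMING (D-0054): THEOREMS ONLY — no definition, no named fact, no instance, no notation, no `sorry`.  Helper toward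
conjunct (8); closes NO stub; 19097 stays OPEN on its 5 registered stubs (v2.17); nothing is booked; BSD₂ is proved for no
supersingular curve and BSD for no curve by any of this; typed ≠ proved.  Generic prime `p`, generic `ℤ_p`-extension `κ` of
`ℚ`, generic finite place `v`; the only input on the local element `g` is that it restricts to a topological generator
(`κ(θ g) = 1`) — no cyclotomic / `v ∣ p` hypothesis, no ×2.

## What and why

Sprung's `Sel♭(E/ℚ_∞)` (`Sprung2012.sharpFlatSelmerInfty … .flat`) is the classical `Sel_{p^∞}(E/ℚ_∞)` cut by the ♭-local Kummer
condition at the chosen place above `v` AND AT ALL ITS CONJUGATES `conj_σ`, `σ ∈ Γ_ℚ`.  Part 1 (`…FlatPTLayerKummerDatum`,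
p832084) produced, from the LAYER condition `loc_n s = κ_{U_n}(Q)` with `Q` a ♭-test point of level `k`, the Kummer datum of
`θ_{n,k}(s)` over `ℚ_∞` and the ♭-local condition at `σ = 1`.  This file supplies the conjugates: every `σ ∈ Γ_ℚ` is `θ(g^j)·u`
with `u ∈ Γ_n` (from `κ(θ g) = 1` alone, `PadicInt.appr`), inner automorphisms act trivially on `H¹(Γ_n, ·)`
(`conjH1_of_mem_holds`), `θ_{n,k}` commutes with conjugation (`AcSigned.toInfty_conjH1`), localisation and the layer Kummer
map are `Γ_v`-equivariant (`LayerPairing.layerLoc_conjMap`, `layerKummer_smul`), and `Ker Col♭` is stable under `z ↦ z ∘ g^j`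
(`SSFlatEC.mem_colemanKer_flat_twist_iff` iterated), so `g^j • Q` is again a ♭-test point.

## What is proved
* §1 `exists_resGalOfEmb_pow_inv_mul_mem_layerSubgroup` — `∀ σ, ∃ j, θ(g^j)⁻¹ σ ∈ Γ_n`.
* §2 `twistEnd_inv_mem_colemanKer_flat`, `twistEnd_pow_inv_mem_colemanKer_flat` — `Ker Col♭` is stable under `Θ_{g⁻¹}` and
  `Θ_{(g^j)⁻¹}` (`z ↦ z ∘ g^j`).
* §3 ★ `conjH1_toInfty_mem_sharpFlatLocalKummerOverOfEmb` — the conjugates clause; ★ `toInfty_mem_sharpFlatSelmerInfty_of_layerLoc_eq_layerKummer`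
  — `θ_{n,k}(s) ∈ Sel_{p^∞}(E/ℚ_∞)` ∧ `loc_n s = κ_{U_n}(Q)` (♭-test `Q`) ⟹ `θ_{n,k}(s) ∈ Sel♭(ℚ_∞)`.

What is NOT here (hF1♭-LEV's): the classical Selmer conditions of `θ_{n,k}(s)` at the primes above `ℓ ≠ p`, above `p`
(automatic for a Kummer class) and at `∞` — joints J3(ℓ), J3(∞) — and the levelwise Poitou–Tate instance J1.

References: [Sprung2012] Def. 5.9 (p. 1495), Def. 7.9, Def. 7.11 (p. 1503); [Kobayashi2003] §2 (p. 4), (8.23) (p. 18);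
[SerreLocalFields1979] VII §5 Prop. 3; [Washington1997] §13.1; [GreenbergLNM1716] §1–§2.
-/

set_option autoImplicit false
-- the Theorems namespace of this sub repeats the summit name by design (D-0017 nested layout)
set_option linter.dupNamespace false

noncomputable section

open scoped Classical NumberField

namespace Summit.BirchSwinnertonDyer.BirchSwinnertonDyer.Theorems

namespace SSFlatPT

open CategoryTheory NumberField IsDedekindDomain Field WeierstrassCurve ContinuousCohomology
  Literature.NumberTheory.EllipticCurves Literature.NumberTheory.GaloisRepresentations
  Literature.NumberTheory.EllipticCurves.Sprung2012 Literature.NumberTheory.EllipticCurves.Sprung2017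
  Literature.NumberTheory.EllipticCurves.Kobayashi2003 Literature.NumberTheory.EllipticCurves.Kato2004
  Literature.NumberTheory.EllipticCurves.Kato2004.EulerSystemValues ZpExtension

variable (W : WeierstrassCurve ℚ) [W.IsElliptic] {p : ℕ} [Fact p.Prime] (κ : ZpExtension ℚ p)
  (v : HeightOneSpectrum (𝓞 ℚ)) {ap : ℤ} {g : absoluteGaloisGroup (v.adicCompletion ℚ)}
  {c : ℕ → localPoints W (v.adicCompletion ℚ)}

/-! ## §1 One orbit from the generator alone: `σ ∈ θ(g)^j · Γ_n` -/

omit [W.IsElliptic] in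
/-- **Every `σ ∈ Γ_ℚ` is `θ(g^j) · u` with `u ∈ Γ_n`** for a local `g` restricting to a topological generator of `Gal(ℚ_∞/ℚ)`
(`κ(θ g) = 1`): take `j ≡ κ(σ) (mod p^n)` (`PadicInt.appr`).  No surjectivity or ramification hypothesis is needed.
[cite: Washington1997, §13.1] [cite: Kobayashi2003, §2 (p. 4)] -/
theorem exists_resGalOfEmb_pow_inv_mul_mem_layerSubgroup
    (hg : κ.IsTopGenerator (resGalOfEmb (closureEmb (K := ℚ) (v.adicCompletion ℚ)) g)) (n : ℕ)
    (σ : absoluteGaloisGroup ℚ) :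
    ∃ j : ℕ, (resGalOfEmb (closureEmb (K := ℚ) (v.adicCompletion ℚ)) (g ^ j))⁻¹ * σ ∈ κ.layerSubgroup n := by
  have hg' : κ (resGalOfEmb (closureEmb (K := ℚ) (v.adicCompletion ℚ)) g) = Multiplicative.ofAdd 1 := hg
  refine ⟨((κ σ).toAdd).appr n, ?_⟩
  rw [mem_layerSubgroup, map_mul, map_inv, map_pow, map_pow, hg', toAdd_mul, toAdd_inv, toAdd_pow, toAdd_ofAdd,
    nsmul_eq_mul, mul_one]
  have h := PadicInt.appr_spec n (κ σ).toAdd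
  rw [Ideal.mem_span_singleton] at h
  have e : -((((κ σ).toAdd).appr n : ℕ) : ℤ_[p]) + (κ σ).toAdd = (κ σ).toAdd - (((κ σ).toAdd).appr n : ℕ) := by ring
  rw [e]
  exact h

/-! ## §2 `Ker Col♭` is stable under `z ↦ z ∘ g^j` -/

omit [W.IsElliptic] in
/-- **`Ker Col♭` is stable under `z ↦ z ∘ g`** (`= Θ_{g⁻¹} z`, `Sprung2012.twistEnd … g⁻¹`): the twist-stability
`SSFlatEC.mem_colemanKer_flat_twist_iff` read for the functional `z ∘ g`, whose `Θ_g`-twist is `z`.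
[cite: Sprung2012, Def. 5.9 (p. 1495) and §2 p. 1486] -/
theorem twistEnd_inv_mem_colemanKer_flat (hap : (p : ℤ) ∣ ap)
    (hg : κ.IsTopGenerator (resGalOfEmb (closureEmb (K := ℚ) (v.adicCompletion ℚ)) g))
    (hc : ∀ n, c n ∈ localLayerPointsOfEmb κ (closureEmb (K := ℚ) (v.adicCompletion ℚ)) W n)
    (hTr : ∀ n, 1 ≤ n → localTraceOfEmb κ (closureEmb (K := ℚ) (v.adicCompletion ℚ)) W n (n + 1) (c (n + 1)) =
      ap • c n - c (n - 1))
    {z : localTowerPointsOfEmb κ (closureEmb (K := ℚ) (v.adicCompletion ℚ)) W →+ ℤ_[p]}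
    (hz : z ∈ colemanKer κ (closureEmb (K := ℚ) (v.adicCompletion ℚ)) W ap g c .flat) :
    twistEnd κ (closureEmb (K := ℚ) (v.adicCompletion ℚ)) W g⁻¹ z ∈
      colemanKer κ (closureEmb (K := ℚ) (v.adicCompletion ℚ)) W ap g c .flat := by
  refine (SSFlatEC.mem_colemanKer_flat_twist_iff κ (closureEmb (K := ℚ) (v.adicCompletion ℚ)) W hap hg hc hTr
    (z := twistEnd κ (closureEmb (K := ℚ) (v.adicCompletion ℚ)) W g⁻¹ z) (z' := z) fun y ↦ ?_).mp hz
  rw [twistEnd_apply]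
  congr 1
  exact Subtype.ext (by simp)

omit [W.IsElliptic] in
/-- **`Ker Col♭` is stable under `z ↦ z ∘ g^j`** (`Θ_{(g^j)⁻¹} z`), by induction on `j`.
[cite: Sprung2012, Def. 5.9 (p. 1495) and §2 p. 1486] -/
theorem twistEnd_pow_inv_mem_colemanKer_flat (hap : (p : ℤ) ∣ ap)
    (hg : κ.IsTopGenerator (resGalOfEmb (closureEmb (K := ℚ) (v.adicCompletion ℚ)) g))
    (hc : ∀ n, c n ∈ localLayerPointsOfEmb κ (closureEmb (K := ℚ) (v.adicCompletion ℚ)) W n)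
    (hTr : ∀ n, 1 ≤ n → localTraceOfEmb κ (closureEmb (K := ℚ) (v.adicCompletion ℚ)) W n (n + 1) (c (n + 1)) =
      ap • c n - c (n - 1))
    {z : localTowerPointsOfEmb κ (closureEmb (K := ℚ) (v.adicCompletion ℚ)) W →+ ℤ_[p]}
    (hz : z ∈ colemanKer κ (closureEmb (K := ℚ) (v.adicCompletion ℚ)) W ap g c .flat) (j : ℕ) :
    twistEnd κ (closureEmb (K := ℚ) (v.adicCompletion ℚ)) W (g ^ j)⁻¹ z ∈
      colemanKer κ (closureEmb (K := ℚ) (v.adicCompletion ℚ)) W ap g c .flat := by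
  induction j with
  | zero =>
    have h0 : twistEnd κ (closureEmb (K := ℚ) (v.adicCompletion ℚ)) W (g ^ 0)⁻¹ z = z := by
      refine AddMonoidHom.ext fun y ↦ ?_
      rw [twistEnd_apply]
      congr 1
      exact Subtype.ext (by simp)
    rw [h0]
    exact hz
  | succ j ih =>
    have hstep : twistEnd κ (closureEmb (K := ℚ) (v.adicCompletion ℚ)) W (g ^ (j + 1))⁻¹ z =
        twistEnd κ (closureEmb (K := ℚ) (v.adicCompletion ℚ)) W g⁻¹
          (twistEnd κ (closureEmb (K := ℚ) (v.adicCompletion ℚ)) W (g ^ j)⁻¹ z) := by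
      refine AddMonoidHom.ext fun y ↦ ?_
      rw [twistEnd_apply, twistEnd_apply, twistEnd_apply]
      congr 1
      exact Subtype.ext (by simp only [inv_inv]; rw [smul_smul, ← pow_succ])
    rw [hstep]
    exact twistEnd_inv_mem_colemanKer_flat W κ v hap hg hc hTr ih

/-! ## §3 The ♭-local condition of `θ_{n,k}(s)` at EVERY conjugate -/

/-- ★ **The conjugates clause of `Sel♭` for `θ_{n,k}(s)`.**  Let `s ∈ H¹(ℚ_n, W[p^k])` with `loc_n s = κ_{U_n}(Q)` for a ♭-TEST
POINT `Q ∈ E(ℚ_{n,v})` of level `k` (`p^k ∣ z'(Q)` for all `z' ∈ Ker Col♭`).  Then for EVERY `σ ∈ Γ_ℚ` the conjugate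
`conj_σ θ_{n,k}(s)` satisfies Sprung's ♭-local Kummer condition at the chosen place above `v` — the `⨅_σ` clause of
`Sprung2012.sharpFlatSelmerInfty`.  Proof: `σ = θ(g^j)·u` with `u ∈ Γ_n` (§1); `conj_u s = s` (inner automorphisms,
`conjH1_of_mem_holds`), `θ_{n,k}` commutes with `conj` (`AcSigned.toInfty_conjH1`), `loc_n(conj_{θ(g^j)} s) = κ_{U_n}(g^j • Q)`
(`LayerPairing.layerLoc_conjMap`, `layerKummer_smul`), and `g^j • Q` is again a ♭-test point because `Ker Col♭` is stable under
`z ↦ z ∘ g^j` (§2); conclude by `toInfty_mem_sharpFlatLocalKummerOverOfEmb_of_layerLoc_eq_layerKummer`.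
[cite: Sprung2012, Def. 7.9 and Def. 7.11 (p. 1503)] [cite: Kobayashi2003, §2 (p. 4), (8.23) (p. 18)] [cite: SerreLocalFields1979, VII §5 Prop. 3] -/
theorem conjH1_toInfty_mem_sharpFlatLocalKummerOverOfEmb (hap : (p : ℤ) ∣ ap)
    (hg : κ.IsTopGenerator (resGalOfEmb (closureEmb (K := ℚ) (v.adicCompletion ℚ)) g))
    (hc : ∀ n, c n ∈ localLayerPointsOfEmb κ (closureEmb (K := ℚ) (v.adicCompletion ℚ)) W n)
    (hTr : ∀ n, 1 ≤ n → localTraceOfEmb κ (closureEmb (K := ℚ) (v.adicCompletion ℚ)) W n (n + 1) (c (n + 1)) =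
      ap • c n - c (n - 1))
    (n k : ℕ) (s : W.torsionH1Over ((p : ℤ) ^ k) (κ.layerSubgroup n))
    (Q : localPoints W (v.adicCompletion ℚ))
    (hQ : Q ∈ localLayerPointsOfEmb κ (closureEmb (K := ℚ) (v.adicCompletion ℚ)) W n)
    (h : CyclotomicLayer.layerLoc W (p ^ k) κ v n s =
      CyclotomicLayer.layerKummer W (p ^ k) κ v n ⟨Q, hQ⟩)
    (htest : ∀ z' ∈ colemanKer κ (closureEmb (K := ℚ) (v.adicCompletion ℚ)) W ap g c .flat,
      (p : ℤ_[p]) ^ k ∣ z' ⟨Q, localLayerPointsOfEmb_le_localTowerPointsOfEmb κ _ W n hQ⟩)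
    (σ : absoluteGaloisGroup ℚ) :
    W.conjH1 p κ.kerSubgroup σ (AcSigned.toInfty W p κ n k s) ∈
      sharpFlatLocalKummerOverOfEmb W p κ.kerSubgroup (closureEmb (K := ℚ) (v.adicCompletion ℚ))
        (localTowerPointsOfEmb κ (closureEmb (K := ℚ) (v.adicCompletion ℚ)) W)
        (colemanKer κ (closureEmb (K := ℚ) (v.adicCompletion ℚ)) W ap g c .flat) := by
  obtain ⟨j, hj⟩ := exists_resGalOfEmb_pow_inv_mul_mem_layerSubgroup κ v hg n σ
  set d : absoluteGaloisGroup ℚ := resGalOfEmb (closureEmb (K := ℚ) (v.adicCompletion ℚ)) (g ^ j) with hd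
  -- `conj_σ θ(s) = θ(conj_d s)`
  have h1 : W.conjH1 p κ.kerSubgroup σ (AcSigned.toInfty W p κ n k s) =
      AcSigned.toInfty W p κ n k
        (Literature.NumberTheory.EllipticCurves.conjH1 (κ.layerSubgroup n) (geomTorsion W ((p : ℤ) ^ k)) d s) := by
    have hσ : σ = d * (d⁻¹ * σ) := by rw [mul_inv_cancel_left]
    have e1 : Literature.NumberTheory.EllipticCurves.conjH1 (κ.layerSubgroup n) (geomTorsion W ((p : ℤ) ^ k)) σ s =
        Literature.NumberTheory.EllipticCurves.conjH1 (κ.layerSubgroup n) (geomTorsion W ((p : ℤ) ^ k)) d s := by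
      conv_lhs => rw [hσ]
      rw [Literature.NumberTheory.EllipticCurves.conjH1_mul_holds (κ.layerSubgroup n) _ d (d⁻¹ * σ),
        AddMonoidHom.comp_apply, Literature.NumberTheory.EllipticCurves.conjH1_of_mem_holds _ _ hj,
        AddMonoidHom.id_apply]
    rw [← e1]
    exact (AcSigned.toInfty_conjH1 W p κ n k σ s).symm
  -- `loc_n (conj_d s) = κ_{U_n}(g^j • Q)`
  have h2 : CyclotomicLayer.layerLoc W (p ^ k) κ v n
        (Literature.NumberTheory.EllipticCurves.conjH1 (κ.layerSubgroup n) (geomTorsion W ((p : ℤ) ^ k)) d s) =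
      CyclotomicLayer.layerKummer W (p ^ k) κ v n
        ⟨g ^ j • Q, smul_mem_localLayerPointsOfEmb κ (closureEmb (K := ℚ) (v.adicCompletion ℚ)) W n (g ^ j) hQ⟩ := by
    change SignedKatoOffTwo.LayerPairing.layerLoc W (p ^ k) κ v n
        (conjMap (W.torsionGaloisModule (((p ^ k : ℕ) : ℤ))).toTopRep (κ.layerSubgroup n) d 1 s) =
      SignedKatoOffTwo.LayerPairing.layerKummer W (p ^ k) κ v n
        ⟨g ^ j • Q, smul_mem_localLayerPointsOfEmb κ (closureEmb (K := ℚ) (v.adicCompletion ℚ)) W n (g ^ j) hQ⟩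
    rw [hd, SignedKatoOffTwo.LayerPairing.layerLoc_conjMap,
      SignedKatoOffTwo.LayerPairing.layerKummer_smul W (p ^ k) κ v n (g ^ j) Q hQ]
    exact congrArg _ h
  -- `g^j • Q` is a ♭-test point of level `k`
  have htest' : ∀ z' ∈ colemanKer κ (closureEmb (K := ℚ) (v.adicCompletion ℚ)) W ap g c .flat,
      (p : ℤ_[p]) ^ k ∣ z' ⟨g ^ j • Q, localLayerPointsOfEmb_le_localTowerPointsOfEmb κ _ W n
        (smul_mem_localLayerPointsOfEmb κ (closureEmb (K := ℚ) (v.adicCompletion ℚ)) W n (g ^ j) hQ)⟩ := by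
    intro z' hz'
    have hd' := htest _ (twistEnd_pow_inv_mem_colemanKer_flat W κ v hap hg hc hTr hz' j)
    rw [twistEnd_apply] at hd'
    convert hd' using 2
    exact Subtype.ext (by simp)
  rw [h1]
  exact toInfty_mem_sharpFlatLocalKummerOverOfEmb_of_layerLoc_eq_layerKummer W κ v n k _ (g ^ j • Q)
    (smul_mem_localLayerPointsOfEmb κ (closureEmb (K := ℚ) (v.adicCompletion ℚ)) W n (g ^ j) hQ) h2 htest'

/-- **`θ_{n,k}(s) ∈ Sel♭(ℚ_∞)` from the layer data**, modulo the classical Selmer conditions: if `θ_{n,k}(s)` lies in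
`Sel_{p^∞}(E/ℚ_∞)` (the conditions at the primes above `ℓ ≠ p`, above `p` and at `∞` — the supplier's J3(ℓ), J3(∞)) and
`loc_n s = κ_{U_n}(Q)` for a ♭-test point `Q` of level `k`, then `θ_{n,k}(s) ∈ sharpFlatSelmerInfty … .flat`.
[cite: Sprung2012, Def. 7.11 (p. 1503)] -/
theorem toInfty_mem_sharpFlatSelmerInfty_of_layerLoc_eq_layerKummer (hap : (p : ℤ) ∣ ap)
    (hg : κ.IsTopGenerator (resGalOfEmb (closureEmb (K := ℚ) (v.adicCompletion ℚ)) g))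
    (hc : ∀ n, c n ∈ localLayerPointsOfEmb κ (closureEmb (K := ℚ) (v.adicCompletion ℚ)) W n)
    (hTr : ∀ n, 1 ≤ n → localTraceOfEmb κ (closureEmb (K := ℚ) (v.adicCompletion ℚ)) W n (n + 1) (c (n + 1)) =
      ap • c n - c (n - 1))
    (n k : ℕ) (s : W.torsionH1Over ((p : ℤ) ^ k) (κ.layerSubgroup n))
    (hsel : AcSigned.toInfty W p κ n k s ∈ W.selmerInfty κ)
    (Q : localPoints W (v.adicCompletion ℚ))
    (hQ : Q ∈ localLayerPointsOfEmb κ (closureEmb (K := ℚ) (v.adicCompletion ℚ)) W n)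
    (h : CyclotomicLayer.layerLoc W (p ^ k) κ v n s =
      CyclotomicLayer.layerKummer W (p ^ k) κ v n ⟨Q, hQ⟩)
    (htest : ∀ z' ∈ colemanKer κ (closureEmb (K := ℚ) (v.adicCompletion ℚ)) W ap g c .flat,
      (p : ℤ_[p]) ^ k ∣ z' ⟨Q, localLayerPointsOfEmb_le_localTowerPointsOfEmb κ _ W n hQ⟩) :
    AcSigned.toInfty W p κ n k s ∈
      sharpFlatSelmerInfty W κ (closureEmb (K := ℚ) (v.adicCompletion ℚ)) ap g c .flat :=
  (mem_sharpFlatSelmerInfty_iff W κ _ ap g c .flat _).mpr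
    ⟨hsel, fun σ ↦ conjH1_toInfty_mem_sharpFlatLocalKummerOverOfEmb W κ v hap hg hc hTr n k s Q hQ h htest σ⟩

end SSFlatPT

end Summit.BirchSwinnertonDyer.BirchSwinnertonDyer.Theorems

end
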